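import Literature.AnabelianGeometry.EtaleTheta.Discharge.Sec2InertiaOfCommutatorAxis
import Literature.AnabelianGeometry.EtaleTheta.DoubleUnderlineOfCocycle
import HarnessLib

/-!
# [EtTh] §2 p. 35 over §1: «`D_x → Π^Θ_X` maps the inertia group `I_x` isomorphically ONTO `Δ_Θ`» — the
# INTEGRAL (tempered) form from the commutator axis, and the cuspidal inertia groups of `X̲̲` onto `l·Δ_Θ`

S. Mochizuki, *The étale theta function and its Frobenioid-theoretic manifestations*, Publ. RIMS **45**
(2009) [EtTh], §2, discussion preceding Def. 2.1, PRIMS PDF p. 35 (printed 261): «Let us write `x` for the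
unique cusp of `X^log`. Then there is a natural injective [outer] homomorphism `D_x → Π^Θ_X` — where
`D_x ⊆ Π_X` is the decomposition group associated to `x` — which maps the inertia group `I_x ⊆ D_x`
isomorphically onto `Δ_Θ`» [cite: MochizukiEtTh2009, Def 2.1 p.35]; §1 p. 12 (printed 238): «`Δ_X` … is a
profinite free group on `2` generators», «`Δ^Θ_X := Δ_X/[Δ_X, [Δ_X, Δ_X]]` … `Δ_Θ := [Δ^Θ_X, Δ^Θ_X]`»;
Prop. 2.2 (ii) p. 37 / Prop. 2.12 (i) p. 45: «`Ker(Δ^Θ_* ↠ Δ^ell_*) = l·Δ_Θ`» for the covering `X̲̲`.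

Cell abc-iut, PROOF-ONLY file (0 definitions), seat abc-iut-w5-d165 (gen 4), row «IUTchII:Cor2.5(i)-J1» =
GAP-LEDGER G-w4d005g4-1 (the binder `hgen` of abc-iut-w4-d005's
`Literature.IUT.HodgeArakelov.Subquotient.inf_sup_bot_eq_top_of_generators`, p431116: «`(l·Δ_Θ)(Π_v)` is
generated, over its bottom group, by the cuspidal inertia groups» — print: [IUTchII] Cor. 2.5 (i) p. 72
«follows immediately by considering the cuspidal inertia groups involved»). This is the [EtTh] §1/§2 half:

* §1 **`ThetaSetting.commutatorClosure_eq_closure_zpowers_sup_tripleCommutatorClosure`** — for ANY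
  topological generating pair `a, b` of `Δ_X` (no freeness needed):
  `[Δ_X,Δ_X]⁻ = ⟨[a,b]⟩⁻ · [[Δ_X,Δ_X],Δ_X]⁻` inside `Π_X` — the INTEGRAL analogue of abc-iut-L2-t10's
  mod-`l` `closure_zpowers_commutator_sup_barKerHat` (same class-two normal-form argument of that lineage,
  `DtpYAbelian.commutator_le_zpowers_of_classTwo`; closedness of `⟨[a,b]⟩⁻ · [[Δ_X,Δ_X],Δ_X]⁻` now from the
  COMPACTNESS of `Π_X` (`IsProfiniteCompletion`) instead of a finite union of cosets);
* §2 **`ThetaSetting.map_toTheta_eq_deltaTheta_of_commutatorAxis`** — for every subgroup `I ⊆ Π^tp_X` with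
  `toHat(I) = ⟨[a,b]⟩⁻` (the COMMUTATOR-AXIS clause proposed for the v-next §1 interface, GAP-LEDGER l.273,
  as in `Sec2InertiaOfCommutatorAxis`): `toTheta(I) = Δ_Θ` in `(Π^tp_X)^Θ`; in particular for `I = I_x`
  (`map_toTheta_inertia_eq_deltaTheta_of_commutatorAxis`) and for every conjugate `γ I_x γ⁻¹` — the printed
  «maps `I_x` … onto `Δ_Θ`» in the tree's tempered currency (`Δ_Θ = Ker((Π^tp_X)^Θ ↠ (Π^tp_X)^ell)`);
* §3 **`ThetaSetting.EtaleThetaData.DoubleUnderline.map_toTheta_Huu_inf_eq_lDeltaTheta`** — for abc-iut-L2-t8's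
  covering `C : E.DoubleUnderline l` (`Π^tp_X̲̲ = C.Huu`), every subgroup `I ⊆ Π^tp_X` with `toTheta(I) = Δ_Θ`
  and `Ker(Π^tp_X ↠ (Π^tp_X)^Θ) ⊆ Π^tp_X̲̲`: `toTheta(Π^tp_X̲̲ ∩ I) = l·Δ_Θ` — the cuspidal inertia groups OF `X̲̲`
  (`Π^tp_X̲̲ ∩ γ I_x γ⁻¹`) map ONTO `l·Δ_Θ` (from the field `map_toTheta_Huu : toTheta(Π^tp_X̲̲) ∩ Δ_Θ = l·Δ_Θ`);
* §4 **`XuuCocycleData.ker_toTheta_le_Huu`** — for abc-iut-L2-t7's CONSTRUCTED choice `X̲̲`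
  (`XuuCocycleData.doubleUnderline`, the zero set of the extended theta cocycle) the side condition
  `Ker(Π^tp_X ↠ (Π^tp_X)^Θ) ⊆ Π^tp_X̲̲` HOLDS (the cocycle is tautological on `Δ_Θ`-valued geometric elements,
  field `F_theta`), so §3 applies to it with the commutator-axis clause as the ONLY remaining input.

HONEST LIMITS: the commutator-axis clause «`toHat(I_x) = ⟨[a,b]⟩⁻` for a topological generating pair» is a
HYPOTHESIS (the §1 interface `TemperedCurve`/`ThetaSetting` carries cusps as bare `decomp` data; no model in
the tree satisfies it — the χ-model's synthetic cusp is toral, `SettingModelCuspAxis`); nothing of [EtTh] is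
asserted; no new `Prop` fact, no definition, zero edit of any other seat's file; no side is taken on
[IUTchIII] Cor. 3.12; typed ≠ proved.
-/

noncomputable section

namespace Literature.AnabelianGeometry.EtaleTheta

open scoped commutatorElement Pointwise
open _root_.Topology Literature.AnabelianGeometry.SemiGraphs DtpYAbelian

namespace ThetaSetting

variable {p : ℕ} [Fact p.Prime] (D : ThetaSetting p)

/-! ## §1. `[Δ_X,Δ_X]⁻ = ⟨[a,b]⟩⁻ · [[Δ_X,Δ_X],Δ_X]⁻` for any topological generating pair `a, b` of `Δ_X` -/

/-- **Class-two normal forms, integral form**: if `a, b ∈ Δ_X` topologically generate `Δ_X`, then the closed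
commutator subgroup `[Δ_X,Δ_X]⁻` lies in `⟨[a,b]⟩⁻ · [[Δ_X,Δ_X],Δ_X]⁻` (every commutator of the dense subgroup
`⟨a,b⟩` is a power of `[a,b]` modulo `[[Δ_X,Δ_X],Δ_X]`; the product of the COMPACT `⟨[a,b]⟩⁻` with the closed
normal `[[Δ_X,Δ_X],Δ_X]⁻` is closed, hence contains all commutators of `Δ_X` and then their closure).
«`Δ_Θ := [Δ^Θ_X, Δ^Θ_X] (≅ Ẑ(1))`» is procyclic on the class of `[a,b]`. [cite: MochizukiEtTh2009, §1 p.12] -/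
theorem commutatorClosure_le_closure_zpowers_sup_tripleCommutatorClosure {a b : D.DeltaHat}
    (hdense : (Subgroup.closure ({a, b} : Set D.DeltaHat)).topologicalClosure = ⊤) :
    (⁅D.DeltaHat, D.DeltaHat⁆).topologicalClosure ≤
      (Subgroup.zpowers (⁅(a : D.PiHat), (b : D.PiHat)⁆)).topologicalClosure ⊔
        (⁅⁅D.DeltaHat, D.DeltaHat⁆, D.DeltaHat⁆).topologicalClosure := by
  classical
  haveI : T2Space D.PiHat := D.isProfiniteCompletion_toHat.t2Space
  haveI : CompactSpace D.PiHat := D.isProfiniteCompletion_toHat.compactSpace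
  haveI : D.DeltaHat.Normal := D.deltaHat_normal'
  set N : Subgroup D.PiHat := (⁅⁅D.DeltaHat, D.DeltaHat⁆, D.DeltaHat⁆).topologicalClosure with hNdef
  haveI hNn : N.Normal := Subgroup.is_normal_topologicalClosure _
  have hNclosed : IsClosed (N : Set D.PiHat) := Subgroup.isClosed_topologicalClosure _
  set c : D.PiHat := ⁅(a : D.PiHat), (b : D.PiHat)⁆ with hcdef
  set Z : Subgroup D.PiHat := (Subgroup.zpowers c).topologicalClosure with hZdef
  -- ### `U := Z · N`, a closed subgroup of `Π_X`
  have hUcoe : ((Z ⊔ N : Subgroup D.PiHat) : Set D.PiHat) = (Z : Set D.PiHat) * (N : Set D.PiHat) :=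
    Subgroup.mul_normal Z N
  have hZcpt : IsCompact (Z : Set D.PiHat) := (Subgroup.isClosed_topologicalClosure _).isCompact
  have hUclosed : IsClosed ((Z ⊔ N : Subgroup D.PiHat) : Set D.PiHat) := by
    rw [hUcoe]
    exact hNclosed.mul_left_of_isCompact hZcpt
  -- commutators of elements of the dense `⟨a, b⟩` lie in `⟨c⟩ · N` (class-two normal forms modulo `N`)
  have hU_comm_gen : ∀ u ∈ Subgroup.closure ({a, b} : Set D.DeltaHat),
      ∀ v ∈ Subgroup.closure ({a, b} : Set D.DeltaHat), ⁅(u : D.PiHat), (v : D.PiHat)⁆ ∈ Z ⊔ N := by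
    intro u hu v hv
    let π : D.PiHat →* D.PiHat ⧸ N := QuotientGroup.mk' N
    let A : Subgroup (D.PiHat ⧸ N) :=
      ((Subgroup.closure ({a, b} : Set D.DeltaHat)).map D.DeltaHat.subtype).map π
    have hAgen : A = Subgroup.closure ({π a, π b} : Set (D.PiHat ⧸ N)) := by
      simp only [A, MonoidHom.map_closure, Set.image_pair, Subgroup.coe_subtype]
    have hAle : A ≤ (D.DeltaHat.map π) := Subgroup.map_mono (Subgroup.map_subtype_le _)
    have h3 : ⁅⁅A, A⁆, A⁆ = ⊥ := by
      rw [eq_bot_iff]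
      calc ⁅⁅A, A⁆, A⁆ ≤ ⁅⁅D.DeltaHat.map π, D.DeltaHat.map π⁆, D.DeltaHat.map π⁆ :=
            Subgroup.commutator_mono (Subgroup.commutator_mono hAle hAle) hAle
        _ = (⁅⁅D.DeltaHat, D.DeltaHat⁆, D.DeltaHat⁆).map π := by
            rw [Subgroup.map_commutator, Subgroup.map_commutator]
        _ ≤ N.map π := Subgroup.map_mono (Subgroup.le_topologicalClosure _)
        _ = ⊥ := by
            rw [eq_bot_iff]
            rintro _ ⟨k, hk, rfl⟩
            exact (QuotientGroup.eq_one_iff k).mpr hk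
    have hαA : π a ∈ A := by rw [hAgen]; exact Subgroup.subset_closure (Set.mem_insert _ _)
    have hβA : π b ∈ A := by
      rw [hAgen]; exact Subgroup.subset_closure (Set.mem_insert_of_mem _ (Set.mem_singleton _))
    have hcyc := commutator_le_zpowers_of_classTwo A hαA hβA hAgen.le h3
    have huA : π u ∈ A := ⟨u, ⟨u, hu, rfl⟩, rfl⟩
    have hvA : π v ∈ A := ⟨v, ⟨v, hv, rfl⟩, rfl⟩
    have hmem : ⁅π u, π v⁆ ∈ Subgroup.zpowers ⁅π a, π b⁆ :=
      hcyc (Subgroup.commutator_mem_commutator huA hvA)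
    obtain ⟨m, hm⟩ := Subgroup.mem_zpowers_iff.mp hmem
    rw [← map_commutatorElement, ← map_commutatorElement, ← hcdef, ← map_zpow] at hm
    have hk : (c ^ m)⁻¹ * ⁅(u : D.PiHat), (v : D.PiHat)⁆ ∈ N := by
      rw [← QuotientGroup.eq]; exact hm
    have hcm : c ^ m ∈ Z := Subgroup.le_topologicalClosure _ (Subgroup.zpow_mem_zpowers c m)
    have : c ^ m * ((c ^ m)⁻¹ * ⁅(u : D.PiHat), (v : D.PiHat)⁆) ∈ Z ⊔ N := Subgroup.mul_mem_sup hcm hk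
    rwa [mul_inv_cancel_left] at this
  -- all commutators of `Δ_X` lie in `U` (density of `⟨a, b⟩`, closedness of `U`)
  have hU_comm : ⁅D.DeltaHat, D.DeltaHat⁆ ≤ Z ⊔ N := by
    refine Subgroup.commutator_le.mpr fun u hu v hv => ?_
    let T : Set (D.DeltaHat × D.DeltaHat) :=
      {q | ⁅((q.1 : D.DeltaHat) : D.PiHat), ((q.2 : D.DeltaHat) : D.PiHat)⁆ ∈ Z ⊔ N}
    have hTclosed : IsClosed T := by
      refine hUclosed.preimage ?_
      have h1 : Continuous fun q : D.DeltaHat × D.DeltaHat => ((q.1 : D.DeltaHat) : D.PiHat) :=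
        continuous_subtype_val.comp continuous_fst
      have h2 : Continuous fun q : D.DeltaHat × D.DeltaHat => ((q.2 : D.DeltaHat) : D.PiHat) :=
        continuous_subtype_val.comp continuous_snd
      simp only [commutatorElement_def]
      exact ((h1.mul h2).mul h1.inv).mul h2.inv
    have hAdense : Dense ((Subgroup.closure ({a, b} : Set D.DeltaHat) : Subgroup D.DeltaHat) :
        Set D.DeltaHat) := by
      rw [dense_iff_closure_eq, ← Subgroup.topologicalClosure_coe, hdense, Subgroup.coe_top]
    have hsub : ((Subgroup.closure ({a, b} : Set D.DeltaHat) : Set D.DeltaHat) ×ˢ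
        (Subgroup.closure ({a, b} : Set D.DeltaHat) : Set D.DeltaHat)) ⊆ T := by
      rintro ⟨u', v'⟩ ⟨hu', hv'⟩
      exact hU_comm_gen u' hu' v' hv'
    have hT : T = Set.univ := by
      refine Set.eq_univ_of_univ_subset ?_
      rw [← (hAdense.prod hAdense).closure_eq]
      exact hTclosed.closure_subset_iff.mpr hsub
    have : ((⟨u, hu⟩ : D.DeltaHat), (⟨v, hv⟩ : D.DeltaHat)) ∈ T := by rw [hT]; trivial
    exact this
  exact Subgroup.topologicalClosure_minimal _ hU_comm hUclosed

/-- **`[Δ_X,Δ_X]⁻ = ⟨[a,b]⟩⁻ · [[Δ_X,Δ_X],Δ_X]⁻`** for any topological generating pair `a, b` of `Δ_X`: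
«`Δ_Θ := [Δ^Θ_X, Δ^Θ_X]`» is topologically generated by the class of `[a,b]` (integral form of
abc-iut-L2-t10's `closure_zpowers_commutator_sup_barKerHat`). [cite: MochizukiEtTh2009, §1 p.12] -/
theorem commutatorClosure_eq_closure_zpowers_sup_tripleCommutatorClosure {a b : D.DeltaHat}
    (hdense : (Subgroup.closure ({a, b} : Set D.DeltaHat)).topologicalClosure = ⊤) :
    (⁅D.DeltaHat, D.DeltaHat⁆).topologicalClosure =
      (Subgroup.zpowers (⁅(a : D.PiHat), (b : D.PiHat)⁆)).topologicalClosure ⊔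
        (⁅⁅D.DeltaHat, D.DeltaHat⁆, D.DeltaHat⁆).topologicalClosure := by
  haveI : D.DeltaHat.Normal := D.deltaHat_normal'
  refine le_antisymm (D.commutatorClosure_le_closure_zpowers_sup_tripleCommutatorClosure hdense)
    (sup_le ?_ ?_)
  · refine Subgroup.topologicalClosure_minimal _ ?_ (Subgroup.isClosed_topologicalClosure _)
    rw [Subgroup.zpowers_le]
    exact Subgroup.le_topologicalClosure _ (Subgroup.commutator_mem_commutator a.2 b.2)
  · exact Subgroup.topologicalClosure_mono (Subgroup.commutator_le_left _ _)

/-! ## §2. `toTheta(I) = Δ_Θ` for every subgroup on the commutator axis -/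

/-- **Into `Δ_Θ`**: a subgroup `I ⊆ Π^tp_X` whose image in `Π_X` lies in `[Δ_X,Δ_X]⁻` maps into
`Δ_Θ = Ker((Π^tp_X)^Θ ↠ (Π^tp_X)^ell)` (root axiom `ker_toEll`). [cite: MochizukiEtTh2009, §1 p.12] -/
theorem map_toTheta_le_deltaTheta_of_map_toHat_le {I : Subgroup D.PiTemp}
    (hI : I.map D.toHat.toMonoidHom ≤ (⁅D.DeltaHat, D.DeltaHat⁆).topologicalClosure) :
    I.map D.toTheta ≤ D.DeltaTheta := by
  rintro _ ⟨g, hg, rfl⟩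
  have hker : g ∈ (D.thetaToEll.comp D.toTheta).ker := by
    rw [D.ker_toEll, Subgroup.mem_comap]
    exact hI ⟨g, hg, rfl⟩
  exact hker

/-- **«`D_x → Π^Θ_X` … maps the inertia group `I_x` … ONTO `Δ_Θ`», integral tempered form from the
commutator axis**: if `a, b ∈ Δ_X` topologically generate `Δ_X` and a subgroup `I ⊆ Π^tp_X` has
`toHat(I) = ⟨[a,b]⟩⁻` (the closed procyclic subgroup on the boundary commutator), then
`toTheta(I) = Δ_Θ` in `(Π^tp_X)^Θ`. Proof: `Δ_Θ = toTheta(toHat⁻¹[Δ_X,Δ_X]⁻)` (axioms `ker_toEll`,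
`toTheta` onto) and `[Δ_X,Δ_X]⁻ = toHat(I) · Ker`-of-`toTheta`-image (§1 with axiom `ker_toTheta`).
[cite: MochizukiEtTh2009, Def 2.1 p.35] -/
theorem map_toTheta_eq_deltaTheta_of_commutatorAxis {a b : D.DeltaHat}
    (hdense : (Subgroup.closure ({a, b} : Set D.DeltaHat)).topologicalClosure = ⊤)
    {I : Subgroup D.PiTemp}
    (hI : I.map D.toHat.toMonoidHom = (Subgroup.zpowers (⁅(a : D.PiHat), (b : D.PiHat)⁆)).topologicalClosure) :
    I.map D.toTheta = D.DeltaTheta := by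
  haveI : D.DeltaHat.Normal := D.deltaHat_normal'
  set N : Subgroup D.PiHat := (⁅⁅D.DeltaHat, D.DeltaHat⁆, D.DeltaHat⁆).topologicalClosure with hNdef
  haveI hNn : N.Normal := Subgroup.is_normal_topologicalClosure _
  have hsplit := D.commutatorClosure_eq_closure_zpowers_sup_tripleCommutatorClosure hdense
  refine le_antisymm (D.map_toTheta_le_deltaTheta_of_map_toHat_le ?_) ?_
  · rw [hI, hsplit]
    exact le_sup_left
  · intro z hz
    obtain ⟨g, rfl⟩ := D.toTheta_surjective z
    -- `toHat g ∈ [Δ_X,Δ_X]⁻ = toHat(I) · N`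
    have hg : D.toHat.toMonoidHom g ∈ I.map D.toHat.toMonoidHom ⊔ N := by
      have h1 : g ∈ (D.thetaToEll.comp D.toTheta).ker := hz
      rw [D.ker_toEll, Subgroup.mem_comap, hsplit, ← hI] at h1
      exact h1
    rw [← SetLike.mem_coe, Subgroup.mul_normal] at hg
    obtain ⟨_, ⟨i, hi, rfl⟩, n, hn, heq⟩ := Set.mem_mul.mp hg
    -- `i⁻¹ g ∈ Ker(toTheta)`
    have hker : i⁻¹ * g ∈ D.toTheta.ker := by
      rw [D.ker_toTheta, Subgroup.mem_comap, map_mul, map_inv, ← heq, inv_mul_cancel_left]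
      exact hn
    rw [MonoidHom.mem_ker, map_mul, map_inv, inv_mul_eq_one] at hker
    exact ⟨i, hi, hker⟩

/-- **«maps the inertia group `I_x` … onto `Δ_Θ`»** (p. 35) for a cusp `x` of the §1 curve whose inertia
`I_x = D_x ∩ Δ^tp_X` lies on the commutator axis: `toTheta(I_x) = Δ_Θ`. [cite: MochizukiEtTh2009, Def 2.1 p.35] -/
theorem map_toTheta_inertia_eq_deltaTheta_of_commutatorAxis (x : D.Pt) {a b : D.DeltaHat}
    (hdense : (Subgroup.closure ({a, b} : Set D.DeltaHat)).topologicalClosure = ⊤)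
    (hI : (D.inertia x).map D.toHat.toMonoidHom =
      (Subgroup.zpowers (⁅(a : D.PiHat), (b : D.PiHat)⁆)).topologicalClosure) :
    (D.inertia x).map D.toTheta = D.DeltaTheta :=
  D.map_toTheta_eq_deltaTheta_of_commutatorAxis hdense hI

/-- **Conjugates**: if `toTheta(I) = Δ_Θ` then `toTheta(γ I γ⁻¹) = Δ_Θ` for every `γ ∈ Π^tp_X` (`Δ_Θ` is
normal in `(Π^tp_X)^Θ`) — every cuspidal inertia group of `Π^tp_X`, not only the representative `I_x`, maps
onto `Δ_Θ`. [cite: MochizukiEtTh2009, Def 2.1 p.35] -/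
theorem map_toTheta_conj_eq_deltaTheta {I : Subgroup D.PiTemp} (hI : I.map D.toTheta = D.DeltaTheta)
    (γ : D.PiTemp) : (MulAut.conj γ • I).map D.toTheta = D.DeltaTheta := by
  have h : (MulAut.conj γ • I).map D.toTheta = MulAut.conj (D.toTheta γ) • I.map D.toTheta := by
    rw [Subgroup.pointwise_smul_def, Subgroup.pointwise_smul_def, Subgroup.map_map, Subgroup.map_map]
    congr 1
    ext y
    simp [MulAut.conj_apply]
  rw [h, hI]
  exact Subgroup.Normal.conj_smul_eq_self _ _

/-! ## §3. The cuspidal inertia groups OF `X̲̲` map onto `l·Δ_Θ` -/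

namespace EtaleThetaData.DoubleUnderline

variable {D} {E : D.EtaleThetaData} {l : ℕ} (C : E.DoubleUnderline l)

/-- **`toTheta(Π^tp_X̲̲ ∩ I) ⊆ l·Δ_Θ`** for every subgroup `I ⊆ Π^tp_X` mapping into `Δ_Θ` — from abc-iut-L2-t8's
field `map_toTheta_Huu` («`Ker(Δ^Θ_* ↠ Δ^ell_*) = l·Δ_Θ`», Prop. 2.2 (ii) p. 37 / Prop. 2.12 (i) p. 45).
[cite: MochizukiEtTh2009, Prop 2.12 (i) p.45] -/
theorem map_toTheta_Huu_inf_le_lDeltaTheta {I : Subgroup D.PiTemp} (hI : I.map D.toTheta ≤ D.DeltaTheta) :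
    (C.Huu ⊓ I).map D.toTheta ≤ D.lDeltaTheta l := by
  rw [← C.map_toTheta_Huu]
  exact (Subgroup.map_inf_le _ _ _).trans (inf_le_inf_left _ hI)

/-- **The cuspidal inertia groups OF `X̲̲` map ONTO `l·Δ_Θ`**: for every subgroup `I ⊆ Π^tp_X` with
`toTheta(I) = Δ_Θ` (a cuspidal inertia group of `Π^tp_X`, §2) and `Ker(Π^tp_X ↠ (Π^tp_X)^Θ) ⊆ Π^tp_X̲̲` (the
covering `X̲̲ → X` is of type `(1, (ℤ/lℤ)^Θ)`, Def. 2.5 (i): dominated by the theta quotient — §4 proves it for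
the constructed choice), `toTheta(Π^tp_X̲̲ ∩ I) = l·Δ_Θ`: the inertia group `Π^tp_X̲̲ ∩ I` of the cusp of `X̲̲`
under the given cusp of `X` generates `l·Δ_Θ = Ker(Δ^Θ_* ↠ Δ^ell_*)`. [cite: MochizukiEtTh2009, Prop 2.12 (i) p.45] -/
theorem map_toTheta_Huu_inf_eq_lDeltaTheta {I : Subgroup D.PiTemp} (hI : I.map D.toTheta = D.DeltaTheta)
    (hker : D.toTheta.ker ≤ C.Huu) : (C.Huu ⊓ I).map D.toTheta = D.lDeltaTheta l := by
  refine le_antisymm (C.map_toTheta_Huu_inf_le_lDeltaTheta hI.le) fun z hz => ?_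
  have hzH : z ∈ C.Huu.map D.toTheta ⊓ D.DeltaTheta := by rw [C.map_toTheta_Huu]; exact hz
  obtain ⟨⟨h, hh, rfl⟩, hzΔ⟩ := hzH
  rw [← hI] at hzΔ
  obtain ⟨i, hi, hih⟩ := hzΔ
  -- `i h⁻¹ ∈ Ker(toTheta) ⊆ Π^tp_X̲̲`, so `i ∈ Π^tp_X̲̲`
  have hk : i * h⁻¹ ∈ C.Huu := hker (by rw [MonoidHom.mem_ker, map_mul, map_inv, hih, mul_inv_cancel])
  have hiH : i ∈ C.Huu := by simpa using C.Huu.mul_mem hk hh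
  exact ⟨i, ⟨hiH, hi⟩, hih⟩

/-- The same for the CONJUGATES `γ I γ⁻¹` (all the cusps of `X̲̲`: `Π^tp_X̲̲ ∩ γ I_x γ⁻¹`, `γ ∈ Π^tp_X`).
[cite: MochizukiEtTh2009, Prop 2.12 (i) p.45] -/
theorem map_toTheta_Huu_inf_conj_eq_lDeltaTheta {I : Subgroup D.PiTemp} (hI : I.map D.toTheta = D.DeltaTheta)
    (hker : D.toTheta.ker ≤ C.Huu) (γ : D.PiTemp) :
    (C.Huu ⊓ MulAut.conj γ • I).map D.toTheta = D.lDeltaTheta l :=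
  C.map_toTheta_Huu_inf_eq_lDeltaTheta (D.map_toTheta_conj_eq_deltaTheta hI γ) hker

/-- **Assembled from the commutator axis**: for a topological generating pair `a, b` of `Δ_X`, a cusp `x`
with `toHat(I_x) = ⟨[a,b]⟩⁻`, `Ker(Π^tp_X ↠ (Π^tp_X)^Θ) ⊆ Π^tp_X̲̲` and any `γ ∈ Π^tp_X`:
`toTheta(Π^tp_X̲̲ ∩ γ I_x γ⁻¹) = l·Δ_Θ`. [cite: MochizukiEtTh2009, Def 2.1 p.35] -/
theorem map_toTheta_Huu_inf_conj_inertia_eq_lDeltaTheta_of_commutatorAxis (x : D.Pt) {a b : D.DeltaHat}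
    (hdense : (Subgroup.closure ({a, b} : Set D.DeltaHat)).topologicalClosure = ⊤)
    (hIx : (D.inertia x).map D.toHat.toMonoidHom =
      (Subgroup.zpowers (⁅(a : D.PiHat), (b : D.PiHat)⁆)).topologicalClosure)
    (hker : D.toTheta.ker ≤ C.Huu) (γ : D.PiTemp) :
    (C.Huu ⊓ MulAut.conj γ • D.inertia x).map D.toTheta = D.lDeltaTheta l :=
  C.map_toTheta_Huu_inf_conj_eq_lDeltaTheta
    (D.map_toTheta_inertia_eq_deltaTheta_of_commutatorAxis x hdense hIx) hker γ

end EtaleThetaData.DoubleUnderline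

/-! ## §4. The side condition `Ker(Π^tp_X ↠ (Π^tp_X)^Θ) ⊆ Π^tp_X̲̲` for the CONSTRUCTED choice `X̲̲` -/

namespace EtaleThetaData.XuuCocycleData

variable {D} {E : D.EtaleThetaData} {l : ℕ} (Ξ : XuuCocycleData E l)

/-- **`Ker(Π^tp_X ↠ (Π^tp_X)^Θ) ⊆ Π^tp_X̲̲`** for abc-iut-L2-t7's constructed choice `X̲̲` (`Π^tp_X̲̲ =` the zero
set of the extended theta cocycle `F̄` on `Π^tp_X̲`): a kernel element `g` is geometric with `toTheta g = 1 ∈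
Δ_Θ`, so the tautology field `F_theta` («`F(δ) ≡ θ(δ)^e`») gives `F(g) ∈ l·Δ_Θ`, i.e. `g ∈ Π^tp_X̲̲` — the
covering `X̲̲ → X` of type `(1, (ℤ/lℤ)^Θ)` is dominated by the theta quotient. [cite: MochizukiEtTh2009, Def 2.7 p.41] -/
theorem ker_toTheta_le_Huu : D.toTheta.ker ≤ Ξ.Huu := by
  intro g hg
  have hg1 : D.toTheta g = 1 := hg
  have hgY : g ∈ D.GtpY := D.ker_toEll_le_GtpY (by
    rw [MonoidHom.mem_ker, MonoidHom.coe_comp, Function.comp_apply, hg1, map_one])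
  have hgX : g ∈ D.GtpXu l := D.GtpY_le_GtpXu l hgY
  have hΔ : g ∈ D.DeltaTemp := D.ker_toTheta_le_deltaTemp hg
  have hθ : D.toTheta g ∈ D.DeltaTheta := by rw [hg1]; exact one_mem _
  have hF := Ξ.F_theta ⟨g, hgX⟩ hΔ hθ
  have h1 : (⟨D.toTheta g, hθ⟩ : D.DeltaTheta) = 1 := Subtype.ext hg1
  rw [h1, one_zpow, mul_one, inv_mem_iff, Subgroup.mem_subgroupOf] at hF
  exact (Ξ.mem_Huu_iff hgX).2 ((Ξ.mem_Huu0_iff _).2 hF)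

/-- Hence, for the constructed `X̲̲ = Ξ.doubleUnderline`, every subgroup `I ⊆ Π^tp_X` with `toTheta(I) = Δ_Θ`
gives `toTheta(Π^tp_X̲̲ ∩ γ I γ⁻¹) = l·Δ_Θ` with NO side condition. [cite: MochizukiEtTh2009, Def 2.7 p.41] -/
theorem map_toTheta_Huu_inf_conj_eq_lDeltaTheta {I : Subgroup D.PiTemp}
    (hI : I.map D.toTheta = D.DeltaTheta) (γ : D.PiTemp) :
    (Ξ.doubleUnderline.Huu ⊓ MulAut.conj γ • I).map D.toTheta = D.lDeltaTheta l :=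
  Ξ.doubleUnderline.map_toTheta_Huu_inf_conj_eq_lDeltaTheta hI Ξ.ker_toTheta_le_Huu γ

/-- … in particular from the commutator axis: `toTheta(Π^tp_X̲̲ ∩ γ I_x γ⁻¹) = l·Δ_Θ` for the constructed `X̲̲`,
every cusp `x` with `toHat(I_x) = ⟨[a,b]⟩⁻` and every `γ ∈ Π^tp_X`. [cite: MochizukiEtTh2009, Def 2.1 p.35] -/
theorem map_toTheta_Huu_inf_conj_inertia_eq_lDeltaTheta_of_commutatorAxis (x : D.Pt) {a b : D.DeltaHat}
    (hdense : (Subgroup.closure ({a, b} : Set D.DeltaHat)).topologicalClosure = ⊤)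
    (hIx : (D.inertia x).map D.toHat.toMonoidHom =
      (Subgroup.zpowers (⁅(a : D.PiHat), (b : D.PiHat)⁆)).topologicalClosure) (γ : D.PiTemp) :
    (Ξ.doubleUnderline.Huu ⊓ MulAut.conj γ • D.inertia x).map D.toTheta = D.lDeltaTheta l :=
  Ξ.map_toTheta_Huu_inf_conj_eq_lDeltaTheta
    (D.map_toTheta_inertia_eq_deltaTheta_of_commutatorAxis x hdense hIx) γ

end EtaleThetaData.XuuCocycleData

end ThetaSetting

end Literature.AnabelianGeometry.EtaleTheta

end
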